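import Summits.MatrixMultiplication.OmegaCensus.DihedralLawModOneNonCube
import Summits.MatrixMultiplication.OmegaCensus.CubeLawParityModEight
import HarnessLib

/-!
# No `|A| ≡ 1 (mod 3)` law over any `A` with `dim A/2A ≥ 3`

ω-census, family (b3).  Framing: lottery ticket; floor = certified bounds/negative ranges.

**Theorem (`no_mod_one_law_of_rank_three`).** Let `G` be dihedral-like over a finite abelian group `A` (any `c₀`)
with `|A| ≥ 14`, and suppose `A` has three homomorphisms to `ZMod 2` jointly onto `𝔽₂³` (i.e. `dim A/2A ≥ 3`).  Then NO
TPP triple of `G` attains the law `3|S||T||U| + 8 = 8|A|`.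

*Proof.* A law triple has a non-cube or a cube shape.  Non-cube: `A` is the union of two cosets of a cyclic subgroup
`⟨g⟩` (`two_cosets_of_mod_one_law_of_not_cube`); the image of `⟨g⟩` in `𝔽₂³` is `{0, ψ g}`, so `ψ(A)` has at most
`4` elements — contradicting surjectivity (`psi_not_onto_of_two_cosets`).  Cube `(c,c|d,d|e,e)`, `3cde + 1 = |A|`: by
`cube_part_mod_eight` each of `c, d, e` is `≡ ±1 (mod 8)`, so `cde ≡ ±1 (mod 8)` and `|A| = 3cde + 1 ≡ 4, 6 (mod 8)`;
but a group mapping onto `𝔽₂³` has `8 ∣ |A|` (`eight_dvd_card_of_onto`).  ∎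

So the classification 'law at `|A| ≡ 1 (mod 3)` ⟹ `A` has an element of order `≥ |A|/2`' holds for every `A` of
`2`-rank `≥ 3` (such `A` have no cyclic subgroup of index `≤ 2`, and indeed carry no law triple); what remains open in
general is `2`-rank `≤ 2` (e.g. `ℤ₈², ℤ₄×ℤ₁₆` — settled by computation, `FAMILY-B-ADDENDUM-g5.md` §5 — `ℤ₄²×ℤ₁₃`,
`ℤ₁₀²`, and all odd `|A|` such as `ℤ₇², ℤ₁₁²`).
-/

namespace Summit.MatrixMultiplication.OmegaCensus

open Literature.Combinatorics.Additive Finset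

/-! ## Two facts about groups mapping onto `𝔽₂³` -/

section Onto

variable {A : Type*} [AddCommGroup A] [DecidableEq A] [Fintype A]

/-- A finite abelian group with three homomorphisms to `ZMod 2` jointly onto `𝔽₂³` has order divisible by `8`
(all fibres of `ψ` are translates of the kernel). [folklore] -/
theorem eight_dvd_card_of_onto (ψ₁ ψ₂ ψ₃ : A →+ ZMod 2)
    (hψ : ∀ v : ZMod 2 × ZMod 2 × ZMod 2, ∃ a, (ψ₁ a, ψ₂ a, ψ₃ a) = v) : 8 ∣ Fintype.card A := by
  let Ψ : A → ZMod 2 × ZMod 2 × ZMod 2 := fun a => (ψ₁ a, ψ₂ a, ψ₃ a)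
  have hΨsub : ∀ a b, Ψ (a - b) = Ψ a - Ψ b := fun a b => by
    simp only [Ψ, map_sub, Prod.mk_sub_mk]
  set K := (univ.filter fun a : A => Ψ a = 0) with hK
  have hfib : ∀ v, (univ.filter fun a : A => Ψ a = v).card = K.card := by
    intro v
    obtain ⟨a₀, ha₀⟩ := hψ v
    have hset : (univ.filter fun a : A => Ψ a = v) = K.image fun b => b + a₀ := by
      ext a
      simp only [mem_filter, mem_univ, true_and, mem_image, hK]
      constructor
      · intro ha
        refine ⟨a - a₀, ?_, sub_add_cancel a a₀⟩
        rw [hΨsub, ha]; exact sub_eq_zero.2 ha₀.symm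
      · rintro ⟨b, hb, rfl⟩
        have : Ψ (b + a₀ - a₀) = Ψ (b + a₀) - Ψ a₀ := hΨsub _ _
        rw [add_sub_cancel_right, hb] at this
        have e : Ψ (b + a₀) = Ψ a₀ := by
          have := this.symm; rwa [sub_eq_zero] at this
        rw [e]; exact ha₀
    rw [hset, card_image_of_injective _ (add_left_injective a₀)]
  have hsum : Fintype.card A = ∑ v : ZMod 2 × ZMod 2 × ZMod 2, (univ.filter fun a : A => Ψ a = v).card := by
    rw [← card_univ]; exact card_eq_sum_card_fiberwise (f := Ψ) (t := univ) fun _ _ => mem_univ _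
  rw [hsum, sum_congr rfl fun v _ => hfib v, sum_const, smul_eq_mul]
  exact ⟨K.card, by simp [Fintype.card_prod, ZMod.card]⟩

omit [DecidableEq A] [Fintype A] in
/-- If `A` is the union of two cosets of a cyclic subgroup `⟨g⟩` then no three homomorphisms `A →+ ZMod 2` are jointly
onto `𝔽₂³` (the image would have at most `4` elements). [folklore] -/
theorem psi_not_onto_of_two_cosets {g a b : A}
    (hab : ∀ x : A, x - a ∈ AddSubgroup.zmultiples g ∨ x - b ∈ AddSubgroup.zmultiples g)
    (ψ₁ ψ₂ ψ₃ : A →+ ZMod 2) (hψ : ∀ v : ZMod 2 × ZMod 2 × ZMod 2, ∃ x, (ψ₁ x, ψ₂ x, ψ₃ x) = v) : False := by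
  let Ψ : A →+ ZMod 2 × ZMod 2 × ZMod 2 := (ψ₁.prod (ψ₂.prod ψ₃))
  have hΨ : ∀ x, Ψ x = (ψ₁ x, ψ₂ x, ψ₃ x) := fun x => rfl
  -- integer multiples of a vector of `𝔽₂³` are `0` or the vector
  have hmul : ∀ (u : ZMod 2 × ZMod 2 × ZMod 2) (k : ℤ), k • u = 0 ∨ k • u = u := by
    intro u k
    rw [← Int.cast_smul_eq_zsmul (ZMod 2) k u]
    have hk : ((k : ZMod 2) = 0) ∨ ((k : ZMod 2) = 1) := by
      generalize (k : ZMod 2) = z; fin_cases z; exacts [Or.inl rfl, Or.inr rfl]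
    rcases hk with hk | hk <;> rw [hk]
    · exact Or.inl (zero_smul _ u)
    · exact Or.inr (one_smul _ u)
  -- every value of `Ψ` is one of four vectors
  have himg : ∀ x, Ψ x = Ψ a ∨ Ψ x = Ψ a + Ψ g ∨ Ψ x = Ψ b ∨ Ψ x = Ψ b + Ψ g := by
    intro x
    rcases hab x with hx | hx
    · obtain ⟨k, hk⟩ := AddSubgroup.mem_zmultiples_iff.1 hx
      have e : Ψ x = Ψ a + k • Ψ g := by
        rw [← map_zsmul, hk, map_sub]; abel
      rcases hmul (Ψ g) k with h0 | h1
      · left; rw [e, h0, add_zero]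
      · right; left; rw [e, h1]
    · obtain ⟨k, hk⟩ := AddSubgroup.mem_zmultiples_iff.1 hx
      have e : Ψ x = Ψ b + k • Ψ g := by
        rw [← map_zsmul, hk, map_sub]; abel
      rcases hmul (Ψ g) k with h0 | h1
      · right; right; left; rw [e, h0, add_zero]
      · right; right; right; rw [e, h1]
  -- a fifth vector exists (`𝔽₂³` has `8 > 4` elements)
  set F : Finset (ZMod 2 × ZMod 2 × ZMod 2) := {Ψ a, Ψ a + Ψ g, Ψ b, Ψ b + Ψ g} with hF
  have hFcard : F.card ≤ 4 := by
    rw [hF]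
    refine (card_insert_le _ _).trans ?_
    refine (Nat.succ_le_succ (card_insert_le _ _)).trans ?_
    refine (Nat.succ_le_succ (Nat.succ_le_succ (card_insert_le _ _))).trans ?_
    rw [card_singleton]
  have huniv : (univ : Finset (ZMod 2 × ZMod 2 × ZMod 2)).card = 8 := by
    rw [card_univ]; simp [Fintype.card_prod, ZMod.card]
  have hns : ¬ ((univ : Finset (ZMod 2 × ZMod 2 × ZMod 2)) ⊆ F) := fun hsub => by
    have := card_le_card hsub; omega
  obtain ⟨v, -, hv⟩ := not_subset.1 hns
  obtain ⟨x, hx⟩ := hψ v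
  rw [← hΨ] at hx
  apply hv
  rw [hF, ← hx]
  rcases himg x with e | e | e | e <;> rw [e] <;> simp

end Onto

/-! ## The theorem -/

section DihedralLike

variable {A : Type*} [AddCommGroup A] [DecidableEq A] [Fintype A] {G : Type} [Group G] [DecidableEq G]
  {ρ τ : A → G} {c₀ : A} {S T U : Finset G}

/-- **No `|A| ≡ 1 (mod 3)` law over `A` of `2`-rank `≥ 3`.**  Dihedral-like `G` over `A` (any `c₀`), `|A| ≥ 14`, three
homomorphisms `A →+ ZMod 2` jointly onto `𝔽₂³`: no TPP triple attains `3|S||T||U| + 8 = 8|A|`. [folklore] -/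
theorem no_mod_one_law_of_rank_three
    (hρρ : ∀ a b, ρ a * ρ b = ρ (a + b)) (hρτ : ∀ a b, ρ a * τ b = τ (b - a))
    (hτρ : ∀ a b, τ a * ρ b = τ (a + b)) (hττ : ∀ a b, τ a * τ b = ρ (c₀ + b - a))
    (hρ : Function.Injective ρ) (hτ : Function.Injective τ) (hne : ∀ a b, ρ a ≠ τ b)
    (hsurj : ∀ g, (∃ a, ρ a = g) ∨ (∃ a, τ a = g)) (hA : 14 ≤ Fintype.card A)
    (ψ₁ ψ₂ ψ₃ : A →+ ZMod 2) (hψ : ∀ v : ZMod 2 × ZMod 2 × ZMod 2, ∃ a, (ψ₁ a, ψ₂ a, ψ₃ a) = v)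
    (h : TripleProductProperty S T U) : 3 * (S.card * T.card * U.card) + 8 ≠ 8 * Fintype.card A := by
  intro hV
  have hmod : Fintype.card A % 3 = 1 := by omega
  by_cases hnc : ((univ.filter fun a : A => ρ a ∈ S).card = (univ.filter fun a : A => τ a ∈ S).card ∧
      (univ.filter fun a : A => ρ a ∈ T).card = (univ.filter fun a : A => τ a ∈ T).card ∧
      (univ.filter fun a : A => ρ a ∈ U).card = (univ.filter fun a : A => τ a ∈ U).card)
  · obtain ⟨hS', hT', hU'⟩ := hnc
    have cS := card_eq_parts' hρ hτ hne hsurj S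
    have cT := card_eq_parts' hρ hτ hne hsurj T
    have cU := card_eq_parts' hρ hτ hne hsurj U
    set s₀ := (univ.filter fun a : A => ρ a ∈ S).card with hs₀
    set t₀ := (univ.filter fun a : A => ρ a ∈ T).card with ht₀
    set u₀ := (univ.filter fun a : A => ρ a ∈ U).card with hu₀
    have eS : S.card = 2 * s₀ := by rw [cS, ← hS']; ring
    have eT : T.card = 2 * t₀ := by rw [cT, ← hT']; ring
    have eU : U.card = 2 * u₀ := by rw [cU, ← hU']; ring
    have hprod : 3 * (s₀ * t₀ * u₀) + 1 = Fintype.card A := by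
      rw [eS, eT, eU] at hV; nlinarith
    have m8S := cube_part_mod_eight_left hρρ hρτ hτρ hττ hρ hτ hne hsurj ψ₁ ψ₂ ψ₃ hψ h hS' hT' hU' hV
    have m8T := cube_part_mod_eight hρρ hρτ hτρ hττ hρ hτ hne hsurj ψ₁ ψ₂ ψ₃ hψ h hS' hT' hU' hV
    have m8U := cube_part_mod_eight_right hρρ hρτ hτρ hττ hρ hτ hne hsurj ψ₁ ψ₂ ψ₃ hψ h hS' hT' hU' hV
    obtain ⟨k, hk⟩ := eight_dvd_card_of_onto ψ₁ ψ₂ ψ₃ hψ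
    -- `s₀ t₀ u₀ ≡ ±1 (mod 8)` but `3 s₀ t₀ u₀ + 1 = 8k` needs `s₀ t₀ u₀ ≡ 5 (mod 8)`
    have hst : (s₀ * t₀) % 8 = ((s₀ % 8) * (t₀ % 8)) % 8 := Nat.mul_mod _ _ _
    have hstu : (s₀ * t₀ * u₀) % 8 = ((s₀ * t₀ % 8) * (u₀ % 8)) % 8 := Nat.mul_mod _ _ _
    rcases m8S with hs | hs <;> rcases m8T with ht | ht <;> rcases m8U with hu | hu <;>
      · rw [hs, ht] at hst; rw [hst, hu] at hstu; norm_num at hstu; omega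
  · obtain ⟨g, a, b, hab⟩ :=
      two_cosets_of_mod_one_law_of_not_cube hρρ hρτ hτρ hττ hρ hτ hne hsurj hmod hA h hV hnc
    exact psi_not_onto_of_two_cosets hab ψ₁ ψ₂ ψ₃ hψ

end DihedralLike

end Summit.MatrixMultiplication.OmegaCensus
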